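import Summits.BirchSwinnertonDyer.BirchSwinnertonDyer.Theses.KolyvaginRankRigidityAtTwo
import HarnessLib

/-!
# Route `KolyvaginRankRigidityAtTwo`, item `Assembly` (stmt-BirchSwinnertonDyer-23953)

The assembly of the route as FILED (rev 0 shape):
`KolyvaginNonvanishingAtTwo → KolyvaginCorankRigidityAtTwo → OffHabitatTwoConverse →
PrintedInputsRankOneAtTwo → NoTwoTorsionOverK → Rank1Residual.NonCMTwoConverse`.

Since the declared residual `OffHabitatTwoConverse` carries every case except
«`r = 1` and the 2-adic image is surjective», only that branch needs an argument; it is the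
`r = 1` branch of the route's deciding theorem `closes` (planner-authored, kernel-checked in the
Theses file), replayed here verbatim against the five hypotheses of the filed assembly:
2-parity gives `w(E) = −1`; Modularity + Hoffstein–Luo give a Heegner field `K` with `2` split,
`d_K ≡ 1 (mod 8)` and `L(E^{(d_K)}, 1) ≠ 0`; Kolyvagin–Kato finiteness gives
`corank Sel_{2^∞}(E^{(d_K)}) = 0`; `NoTwoTorsionOverK` gives `E(K)[2] = 0`; V1 gives a non-zero
Kolyvagin class, `heegnerSystem_exists_minimal_kolyvaginClass_ne_zero` one of minimal depth `ν`,
V2 the corank dichotomy, whence `ν = 0`, `n = 1`; the bottom class gives `ord L(E/K) = 1`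
(`heegnerSystem_analyticRankEK_eq_one_of_kolyvaginClass_one_ne_zero`) and
`ord L(E) = ord L(E/K) − ord L(E^{(d_K)}) = 1`.

HONEST FRAMING: this closes the bookkeeping item `Assembly` only; the cruxes V1 (Kolyvagin's
conjecture at `2`), V2 (the structure theorem at `2`) and the residual are hypotheses. BSD is not
proved by this file and rung S3 is not closed by it.
-/

set_option autoImplicit false
-- the Theorems namespace of this sub repeats the summit name by design (D-0017 nested layout)
set_option linter.dupNamespace false

noncomputable section

open scoped Classical

open WeierstrassCurve Literature.NumberTheory.EllipticCurves

namespace Summit.BirchSwinnertonDyer.BirchSwinnertonDyer.Theorems.KolyvaginRankRigidity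

open Summit.BirchSwinnertonDyer.BirchSwinnertonDyer.Theses.KolyvaginRankRigidityAtTwo

/-- **The filed assembly of route `KolyvaginRankRigidityAtTwo`** (item
stmt-BirchSwinnertonDyer-23953): V1 → V2 → residual → printed inputs → (tor) at `2` →
`Rank1Residual.NonCMTwoConverse`. Off the branch «`r = 1` ∧ surjective 2-adic image» the declared
residual `OffHabitatTwoConverse` answers; on it, the `r = 1` branch of the route's deciding
theorem `closes` (BCGS Cor. 1 architecture replayed at `p = 2`). -/
theorem assembly_proof :
    Summit.BirchSwinnertonDyer.BirchSwinnertonDyer.Theses.KolyvaginRankRigidityAtTwo.Assembly := by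
  unfold Summit.BirchSwinnertonDyer.BirchSwinnertonDyer.Theses.KolyvaginRankRigidityAtTwo.Assembly
  intro hV1 hV2 hR hIn hT W _ _ hCM hred r hr hc
  by_cases hsur : (r = 1 ∧ (∀ m : ℕ, W.HasSurjectiveModNGaloisRep (2 ^ m : ℕ)))
  swap
  · exact hR W hCM hred r hr hc hsur
  obtain ⟨rfl, hsur⟩ := hsur
  obtain ⟨hmod, hHL, hpar, hKato, hE, hGZ, hrec⟩ := hIn
  haveI : Fact (Nat.Prime 2) := ⟨Nat.prime_two⟩
  haveI : NeZero (W.conductorNorm ℤ) := ⟨(W.conductorNorm_pos_holds).ne'⟩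
  -- 2-parity: `w(E) = -1`
  have hw : W.rootNumber = -1 := by
    have h := hpar W
    unfold Literature.NumberTheory.EllipticCurves.p_parity at h
    rw [hc, pow_one] at h
    exact h.symm
  -- Heegner field with `2` split, `d_K ≡ 1 (mod 8)`, `L(E^{(d_K)}, 1) ≠ 0` (Modularity + Hoffstein–Luo)
  obtain ⟨K, _, _, hK, -, hHN, hH2, hd8, hL1⟩ :=
    Literature.NumberTheory.EllipticCurves.exists_heegnerField_split_twist_ne_zero_discr_emod_eight_of_hoffsteinLuo
      hmod hHL W hw Nat.prime_two 0
  have hodd : Odd (NumberField.discr K) := by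
    rw [Int.odd_iff]; omega
  have hne3 : NumberField.discr K ≠ -3 := by omega
  have hne4 : NumberField.discr K ≠ -4 := by omega
  have h2d : ¬ ((2 : ℤ) ∣ NumberField.discr K) := by omega
  have hd : (NumberField.discr K : ℚ) ≠ 0 := by exact_mod_cast NumberField.discr_ne_zero K
  haveI := W.isElliptic_quadraticTwist hd
  -- Kolyvagin–Kato: the partner twist has corank `0`
  obtain ⟨-, -, hfin⟩ := hKato (W.quadraticTwist (NumberField.discr K : ℚ)) hL1
  haveI := hfin
  have hc' : (W.quadraticTwist (NumberField.discr K : ℚ)).selmerCorank 2 = 0 :=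
    (W.quadraticTwist (NumberField.discr K : ℚ)).selmerCorank_eq_zero_of_finite 2
  -- (tor) at `2`, V1, minimal non-zero class, V2
  have htor := hT W hsur K hK
  obtain ⟨Dt, β, ι, n, d, M, hn, hM1, hMle, hne⟩ := hV1 W hCM hred hsur K hK hHN hodd hne3 htor hH2
  obtain ⟨n₀, d₀, M₀, hn₀, hM₀, hM₀le, hne₀, hmin⟩ :=
    Literature.NumberTheory.EllipticCurves.heegnerSystem_exists_minimal_kolyvaginClass_ne_zero
      Nat.prime_two d hn hM1 hMle hne
  have hstruct := hV2 W hCM hred hsur K hK hne3 hne4 h2d hHN Dt β ι n₀ d₀ M₀ hn₀ hM₀ hM₀le hne₀ hmin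
  have hν : n₀.primeFactors.card = 0 := by
    rcases hstruct with ⟨h1, h2⟩ | ⟨h1, h2⟩ <;> omega
  have hn1 : n₀ = 1 := by
    rw [Finset.card_eq_zero, Nat.primeFactors_eq_empty] at hν
    rcases hν with h0 | h1
    · exact absurd (h0 ▸ hn₀.1) not_squarefree_zero
    · exact h1
  subst hn1
  -- bottom class: `ord L(E/K) = 1`, hence `ord L(E) = 1`
  have hEK : Literature.NumberTheory.EllipticCurves.analyticRankEK W K = 1 :=
    Literature.NumberTheory.EllipticCurves.heegnerSystem_analyticRankEK_eq_one_of_kolyvaginClass_one_ne_zero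
      (hGZ W _ K) (hrec _ W K) hK rfl hHN d₀ hne₀
  rw [Literature.NumberTheory.EllipticCurves.analyticRankEK_eq_add_of hE W K,
    Literature.NumberTheory.EllipticCurves.analyticRank_eq_zero_of_entireLFunction_one_ne_zero _ hL1,
    add_zero] at hEK
  exact hEK

end Summit.BirchSwinnertonDyer.BirchSwinnertonDyer.Theorems.KolyvaginRankRigidity
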